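import Summits.CriticalPhenomena.CardyFormulaZ2.Theorems.CardyMagicRigidityNestingRigidityNeckCoarseZ2Reduction
import Summits.CriticalPhenomena.CardyFormulaZ2.Theorems.CardyMagicRigidityNestingRigidityNeckCoarseStructure
import Literature.Probability.Percolation.FourArmGarbanShift
import Literature.Probability.Percolation.FourArmGarbanProofs
import Literature.Probability.Percolation.SharpnessDCTProofs
import HarnessLib

/-!
# Crux `NestingRigidity`, line `pinch-resampling` (v4), stub S12: virtual edges, augmented chains and crossing extraction on `ℤ²`

Crux `Summit.CriticalPhenomena.CardyFormulaZ2.Theses.CardyMagicRigidity.NestingRigidity`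
(stmt-CriticalPhenomena-4835), line `pinch-resampling` v4, vocabulary `…PinchResamplingDefsV4` (p152476), stub S12
`stub_neckHookupCoarseZ2 : NeckHookupCoarseZ2` (coarse measurability of the primal hook-up probability of the box
`Λ_s(x)` given its exterior EDGES, critical bond percolation on `ℤ²`).  This is the `ℤ²` port of the lattice-free
bookkeeping of the S11 road map (`…NestingRigidityNeckHookStar`, worker S11) used by the deterministic COVERING
lemmas of the error `ZHookR Δ ZHookStar` (sequel `…NeckZ2CoveringA`):

* §1 Geometry of the sup norm `zNorm` on `ℤ²`: triangle inequality, `1`-Lipschitz along lattice edges, diameter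
  `< ℓ` of an `ℓ`-cell, the norms of inner- and outer-layer vertices of the collar `Λ_{2s}(x) ∖ Λ_s(x)`, and the
  dictionary between the centred square annulus `zAnn w r R = {r ≤ |· - w|_∞ ≤ R}` and the tree's
  `(· + w) '' sqAnnulus r R` / `siteSphere` (`FourArmGarban*.lean`), so that two open crossings of `zAnn w r R` in
  distinct open clusters of the annulus give the tree's cluster-form four-arm event `fourArmTwoClustersAt w r R`
  (`mem_fourArmTwoClustersAt_of_crossings`) — whose two-radius bound with exponent `> 1` is PROVED in the tree
  (`QuadCrossing.fourArm_bound`, `real_fourArmTwoClustersAt`).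
* §2 VIRTUAL EDGES at resolution `ℓ` (`zVEdges`: an inner-layer vertex and an inner-layer vertex of a BIG blob in the
  same `ℓ`-cell), steps of `Λ_{2s}(x)` augmented by a set of virtual edges (`zAugSteps`), and the generic chain
  bookkeeping (`NeckCoarseZ2.zAugChain_exists_step_out`, `zAugChain_symm`, `zAugChain_mono`, `zAugChain_of_pathIn`,
  `real_or_endpoint_of_zAugChain`).
* §3 CROSSING EXTRACTION (`NeckCoarseZ2.openPathIn_last_exit_prefix`, `exists_zAnn_crossing_of_pathIn`): an open lattice
  path from inside `Λ_{r-1}(w)` to outside `Λ_{R-1}(w)` contains an open crossing of `zAnn w r R`.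

All statements are sure-event statements about a configuration `ω`; where lattice geometry of open edges is needed
the hypothesis is `(openGraph ω).Adj a b → (zdGraph 2).Adj a b` (true `P_{1/2}`-a.s.: `ae_subset_edgeSet`).
-/

noncomputable section

namespace Summit.CriticalPhenomena.CardyFormulaZ2.Cruxes.NestingRigidity.PinchResampling

open MeasureTheory Set Literature.Probability.Percolation Literature.Probability.LatticeModels
open ZPinchLocality

namespace NeckCoarseZ2

/-! ## §1 Sup-norm geometry on `ℤ²` -/

/-- The sup norm of a difference is symmetric. -/
theorem zNorm_sub_comm (a b : Site 2) : zNorm (a - b) = zNorm (b - a) := by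
  rw [zNorm_sub, zNorm_sub, abs_sub_comm (a 0), abs_sub_comm (a 1)]

/-- Triangle inequality for the sup norm. -/
theorem zNorm_sub_le_add (a b c : Site 2) : zNorm (a - c) ≤ zNorm (a - b) + zNorm (b - c) := by
  rw [zNorm_sub, zNorm_sub, zNorm_sub]
  have h0 : |a 0 - c 0| ≤ |a 0 - b 0| + |b 0 - c 0| := abs_sub_le _ _ _
  have h1 : |a 1 - c 1| ≤ |a 1 - b 1| + |b 1 - c 1| := abs_sub_le _ _ _
  rcases le_total |a 0 - b 0| |a 1 - b 1| with hab | hab <;>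
    rcases le_total |b 0 - c 0| |b 1 - c 1| with hbc | hbc <;>
    simp only [max_eq_right, max_eq_left, hab, hbc, max_le_iff] <;> constructor <;> linarith

/-- `zNorm (· - w)` is `1`-Lipschitz along lattice edges. -/
theorem zNorm_sub_le_of_adj {a b : Site 2} (hab : (zdGraph 2).Adj a b) (w : Site 2) :
    zNorm (b - w) ≤ zNorm (a - w) + 1 := by
  rw [zNorm_sub, zNorm_sub]
  rw [zdGraph_two_adj_iff] at hab
  simp only [max_le_iff, abs_le]
  have h0 := le_max_left |a 0 - w 0| |a 1 - w 1|
  have h1 := le_max_right |a 0 - w 0| |a 1 - w 1|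
  rw [abs_le] at h0 h1
  omega

/-- Two points in the same `ℓ`-cell are at sup distance `< ℓ`. -/
theorem zNorm_sub_lt_of_cellOf_eq {ℓ : ℕ} (hℓ : 1 ≤ ℓ) {o v v' : Site 2} (h : cellOf ℓ o v = cellOf ℓ o v') :
    zNorm (v - v') < ℓ := by
  have hℓ' : (0 : ℤ) < ℓ := by exact_mod_cast hℓ
  have key : ∀ i, |v i - v' i| < ℓ := by
    intro i
    have hc : (v i - o i) / (ℓ : ℤ) = (v' i - o i) / (ℓ : ℤ) := congrFun h i
    have e1 := Int.mul_ediv_add_emod (v i - o i) (ℓ : ℤ)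
    have e2 := Int.mul_ediv_add_emod (v' i - o i) (ℓ : ℤ)
    have m1 := Int.emod_nonneg (v i - o i) hℓ'.ne'
    have m2 := Int.emod_nonneg (v' i - o i) hℓ'.ne'
    have l1 := Int.emod_lt_of_pos (v i - o i) hℓ'
    have l2 := Int.emod_lt_of_pos (v' i - o i) hℓ'
    rw [hc] at e1
    rw [abs_lt]
    constructor <;> nlinarith
  rw [zNorm_sub]
  have k0 := key 0
  have k1 := key 1
  exact max_lt k0 k1

/-- An inner-layer vertex of the collar `Λ_{2s}(x) ∖ Λ_s(x)` has sup norm `s + 1` from the centre. -/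
theorem zNorm_eq_of_mem_innerLayer {x : Site 2} {s : ℕ} {v : Site 2}
    (hv : v ∈ innerLayer (zdGraph 2) (zBall x s) (zBall x (2 * s))) : zNorm (v - x) = s + 1 := by
  obtain ⟨⟨-, hvI⟩, w, hw, hvw⟩ := hv
  have h1 : zNorm (v - x) ≤ zNorm (w - x) + 1 := zNorm_sub_le_of_adj hvw.symm x
  have h2 : zNorm (w - x) ≤ s := hw
  have h3 : ¬ zNorm (v - x) ≤ s := hvI
  omega

/-- An outer-layer vertex of the collar `Λ_{2s}(x) ∖ Λ_s(x)` has sup norm `2s` from the centre. -/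
theorem zNorm_eq_of_mem_outerLayer {x : Site 2} {s : ℕ} {v : Site 2}
    (hv : v ∈ outerLayer (zdGraph 2) (zBall x s) (zBall x (2 * s))) : zNorm (v - x) = 2 * s := by
  obtain ⟨⟨hvO, -⟩, w, hw, hvw⟩ := hv
  have h1 : zNorm (w - x) ≤ zNorm (v - x) + 1 := zNorm_sub_le_of_adj hvw x
  have h2 : zNorm (v - x) ≤ (2 * s : ℕ) := hvO
  have h3 : ¬ zNorm (w - x) ≤ (2 * s : ℕ) := hw
  push_cast at h2 h3
  omega

/-- The centred square annulus `{r ≤ |y - w|_∞ ≤ R}` around `w`. -/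
def zAnn (w : Site 2) (r R : ℕ) : Set (Site 2) := {y | (r : ℤ) ≤ zNorm (y - w) ∧ zNorm (y - w) ≤ R}

/-- Membership in the sup-norm sphere of the tree (`siteSphere`, `m ≥ 1`) is `zNorm = m`. -/
theorem mem_siteSphere_iff_zNorm {m : ℕ} (hm : 1 ≤ m) {v : Site 2} : v ∈ siteSphere m ↔ zNorm v = m := by
  rw [mem_siteSphere_iff hm, Fin.forall_fin_two, Fin.exists_fin_two, zNorm]
  constructor
  · rintro ⟨⟨h0, h1⟩, h2⟩
    refine le_antisymm (max_le (abs_le.2 ⟨h0.1, h0.2⟩) (abs_le.2 ⟨h1.1, h1.2⟩)) ?_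
    rcases h2 with h | h
    · exact le_max_of_le_left (by rw [le_abs]; omega)
    · exact le_max_of_le_right (by rw [le_abs]; omega)
  · intro h
    have h0 : |v 0| ≤ m := h ▸ le_max_left _ _
    have h1 : |v 1| ≤ m := h ▸ le_max_right _ _
    refine ⟨⟨abs_le.1 h0, abs_le.1 h1⟩, ?_⟩
    rcases max_choice |v 0| |v 1| with hc | hc <;> rw [hc] at h
    · left
      rcases (abs_eq (show (0 : ℤ) ≤ m by positivity)).1 h with h' | h' <;> omega
    · right
      rcases (abs_eq (show (0 : ℤ) ≤ m by positivity)).1 h with h' | h' <;> omega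

/-- The translated square annulus of the tree (`(· + w) '' sqAnnulus r R`, `r ≥ 1`) is `zAnn w r R`. -/
theorem image_add_sqAnnulus_eq_zAnn {r : ℕ} (hr : 1 ≤ r) (w : Site 2) (R : ℕ) :
    (· + w) '' sqAnnulus r R = zAnn w r R := by
  ext y
  simp only [mem_image, zAnn, mem_setOf_eq]
  constructor
  · rintro ⟨v, hv, rfl⟩
    rw [add_sub_cancel_right]
    rw [mem_sqAnnulus_iff hr, Fin.forall_fin_two, Fin.exists_fin_two] at hv
    simp only [zNorm, max_le_iff, le_max_iff, abs_le, le_abs]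
    omega
  · rintro ⟨h1, h2⟩
    refine ⟨y - w, ?_, sub_add_cancel y w⟩
    rw [mem_sqAnnulus_iff hr, Fin.forall_fin_two, Fin.exists_fin_two]
    simp only [zNorm, max_le_iff, le_max_iff, abs_le, le_abs, Pi.sub_apply] at h1 h2 ⊢
    omega

/-- **Two open crossings of `zAnn w r R` in distinct open clusters of the annulus give the tree's cluster-form four-arm
event `fourArmTwoClustersAt w r R`** (`FourArmGarbanShift.lean`). -/
theorem mem_fourArmTwoClustersAt_of_crossings {ω : BondConfig (Site 2)} {w : Site 2} {r R : ℕ} (hr : 1 ≤ r)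
    (hrR : r ≤ R) {p₁ q₁ p₂ q₂ : Site 2} (hp₁ : zNorm (p₁ - w) = r) (hq₁ : zNorm (q₁ - w) = R)
    (hp₂ : zNorm (p₂ - w) = r) (hq₂ : zNorm (q₂ - w) = R) (h₁ : PathIn (openGraph ω) (zAnn w r R) p₁ q₁)
    (h₂ : PathIn (openGraph ω) (zAnn w r R) p₂ q₂) (hn : ¬ PathIn (openGraph ω) (zAnn w r R) p₁ p₂) :
    ω ∈ fourArmTwoClustersAt w r R := by
  have hR : 1 ≤ R := hr.trans hrR
  refine ⟨p₁, (mem_siteSphere_iff_zNorm hr).2 hp₁, p₂, (mem_siteSphere_iff_zNorm hr).2 hp₂, q₁,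
    (mem_siteSphere_iff_zNorm hR).2 hq₁, q₂, (mem_siteSphere_iff_zNorm hR).2 hq₂, ?_, ?_, ?_⟩ <;>
    rw [image_add_sqAnnulus_eq_zAnn hr, DCT16.mem_openConnIn_iff_pathIn]
  exacts [h₁, h₂, hn]

/-! ## §2 Virtual edges and augmented chains -/

/-- **Virtual edges** (fuzzy attachments at resolution `ℓ`, true or false): pairs `(a, c)` of inner-layer vertices of the
collar `Λ_{2s}(x) ∖ Λ_s(x)` in the SAME `ℓ`-cell, `c` lying in a BIG blob (two vertices at sup distance `≥ lam`). -/
def zVEdges (ℓ lam s : ℕ) (x o : Site 2) (ω : BondConfig (Site 2)) : Set (Site 2 × Site 2) :=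
  {q | q.1 ∈ innerLayer (zdGraph 2) (zBall x s) (zBall x (2 * s)) ∧
    q.2 ∈ innerLayer (zdGraph 2) (zBall x s) (zBall x (2 * s)) ∧ cellOf ℓ o q.1 = cellOf ℓ o q.2 ∧
    ∃ w ∈ blobOf (openGraph ω) (zBall x (2 * s) \ zBall x s) q.2,
      ∃ w' ∈ blobOf (openGraph ω) (zBall x (2 * s) \ zBall x s) q.2, (lam : ℤ) ≤ zNorm (w - w')}

/-- **Augmented steps**: real open edges of `Λ_{2s}(x)`, or virtual edges of `F` in either orientation. -/
def zAugSteps (s : ℕ) (x : Site 2) (ω : BondConfig (Site 2)) (F : Set (Site 2 × Site 2)) :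
    Set (Site 2 × Site 2) :=
  {q | ((openGraph ω).Adj q.1 q.2 ∧ q.1 ∈ zBall x (2 * s) ∧ q.2 ∈ zBall x (2 * s)) ∨ q ∈ F ∨ (q.2, q.1) ∈ F}

variable {ℓ lam s : ℕ} {x o : Site 2} {ω : BondConfig (Site 2)}

/-- Along an augmented chain from a point of `P` to a point outside `P` there is a step leaving `P`, preceded by a
chain from the start. -/
theorem zAugChain_exists_step_out {G : Set (Site 2 × Site 2)} {P : Set (Site 2)} {a b : Site 2}
    (h : Relation.ReflTransGen (fun a c ↦ (a, c) ∈ zAugSteps s x ω G) a b) (ha : a ∈ P) (hb : b ∉ P) :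
    ∃ y z, y ∈ P ∧ z ∉ P ∧ (y, z) ∈ zAugSteps s x ω G ∧
      Relation.ReflTransGen (fun a c ↦ (a, c) ∈ zAugSteps s x ω G) a y := by
  induction h with
  | refl => exact (hb ha).elim
  | @tail y z hay hyz ih =>
    by_cases hy : y ∈ P
    · exact ⟨y, z, hy, hb, hyz, hay⟩
    · exact ih hy

/-- The two endpoints of a virtual edge are at sup distance `< ℓ`. -/
theorem zNorm_sub_lt_of_mem_zVEdges (hℓ : 1 ≤ ℓ) {a c : Site 2} (h : (a, c) ∈ zVEdges ℓ lam s x o ω) :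
    zNorm (a - c) < ℓ :=
  zNorm_sub_lt_of_cellOf_eq hℓ h.2.2.1

/-- Virtual edges have both endpoints in the big ball `Λ_{2s}(x)`. -/
theorem mem_zBall_of_mem_zVEdges {e : Site 2 × Site 2} (he : e ∈ zVEdges ℓ lam s x o ω) :
    e.1 ∈ zBall x (2 * s) ∧ e.2 ∈ zBall x (2 * s) :=
  ⟨he.1.1.1, he.2.1.1.1⟩

/-- Augmented steps are symmetric. -/
theorem zAugSteps_symm {F : Set (Site 2 × Site 2)} {a b : Site 2} (h : (a, b) ∈ zAugSteps s x ω F) :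
    (b, a) ∈ zAugSteps s x ω F := by
  rcases h with ⟨hadj, ha, hb⟩ | hF | hF
  · exact Or.inl ⟨hadj.symm, hb, ha⟩
  · exact Or.inr (Or.inr hF)
  · exact Or.inr (Or.inl hF)

/-- Augmented chains are symmetric. -/
theorem zAugChain_symm {F : Set (Site 2 × Site 2)} {a b : Site 2}
    (h : Relation.ReflTransGen (fun a b ↦ (a, b) ∈ zAugSteps s x ω F) a b) :
    Relation.ReflTransGen (fun a b ↦ (a, b) ∈ zAugSteps s x ω F) b a := by
  induction h with
  | refl => exact Relation.ReflTransGen.refl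
  | tail _ hyz ih =>
    exact (Relation.ReflTransGen.single (r := fun a b ↦ (a, b) ∈ zAugSteps s x ω F) (zAugSteps_symm hyz)).trans ih

/-- Augmented chains are monotone in the set of virtual edges. -/
theorem zAugChain_mono {F G : Set (Site 2 × Site 2)} (hFG : F ⊆ G) {a b : Site 2}
    (h : Relation.ReflTransGen (fun a b ↦ (a, b) ∈ zAugSteps s x ω F) a b) :
    Relation.ReflTransGen (fun a b ↦ (a, b) ∈ zAugSteps s x ω G) a b := by
  induction h with
  | refl => exact Relation.ReflTransGen.refl
  | tail _ hab ih =>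
    refine ih.tail ?_
    rcases hab with h1 | h2 | h3
    · exact Or.inl h1
    · exact Or.inr (Or.inl (hFG h2))
    · exact Or.inr (Or.inr (hFG h3))

/-- A real open path inside a subset of `Λ_{2s}(x)` is an augmented chain (for any `F`). -/
theorem zAugChain_of_pathIn (F : Set (Site 2 × Site 2)) {B : Set (Site 2)} (hB : B ⊆ zBall x (2 * s)) {a b : Site 2}
    (hp : PathIn (openGraph ω) B a b) :
    Relation.ReflTransGen (fun a b ↦ (a, b) ∈ zAugSteps s x ω F) a b := by
  obtain ⟨ha, p⟩ := hp
  induction p with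
  | refl => exact Relation.ReflTransGen.refl
  | @tail y z hay hyz ih =>
    have hy : y ∈ B := PathIn.right_mem (show PathIn (openGraph ω) _ a y from ⟨ha, hay⟩)
    exact ih.tail (Or.inl ⟨hyz.1, hB hy, hB hyz.2⟩)

/-- **Real classes along an augmented chain**: a point reached from `b` by an augmented chain over `G` is joined by a
real open path of `Λ_{2s}(x)` either to `b` or to an endpoint of a virtual edge of `G`. -/
theorem real_or_endpoint_of_zAugChain {G : Set (Site 2 × Site 2)}
    (hG : ∀ e ∈ G, e.1 ∈ zBall x (2 * s) ∧ e.2 ∈ zBall x (2 * s)) {b z : Site 2} (hb : b ∈ zBall x (2 * s))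
    (h : Relation.ReflTransGen (fun a b ↦ (a, b) ∈ zAugSteps s x ω G) b z) :
    PathIn (openGraph ω) (zBall x (2 * s)) b z ∨
      ∃ e ∈ G, PathIn (openGraph ω) (zBall x (2 * s)) e.1 z ∨ PathIn (openGraph ω) (zBall x (2 * s)) e.2 z := by
  induction h with
  | refl => exact Or.inl (PathIn.refl hb)
  | @tail y z _ hyz ih =>
    rcases hyz with ⟨hadj, -, hzO⟩ | hF | hF
    · rcases ih with h1 | ⟨e, he, h2 | h2⟩
      · exact Or.inl (h1.tail hadj hzO)
      · exact Or.inr ⟨e, he, Or.inl (h2.tail hadj hzO)⟩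
      · exact Or.inr ⟨e, he, Or.inr (h2.tail hadj hzO)⟩
    · exact Or.inr ⟨(y, z), hF, Or.inr (PathIn.refl (hG _ hF).2)⟩
    · exact Or.inr ⟨(z, y), hF, Or.inl (PathIn.refl (hG _ hF).1)⟩

/-- Virtual edges form a finite set (both endpoints lie in `Λ_{2s}(x)`). -/
theorem zVEdges_finite (ℓ lam s : ℕ) (x o : Site 2) (ω : BondConfig (Site 2)) : (zVEdges ℓ lam s x o ω).Finite :=
  ((zBall_finite x (2 * s)).prod (zBall_finite x (2 * s))).subset fun _ he ↦
    ⟨(mem_zBall_of_mem_zVEdges he).1, (mem_zBall_of_mem_zVEdges he).2⟩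

/-- A crossing vertex of the collar has a BIG blob (two vertices at sup distance `≥ lam`, once `lam + 1 ≤ s`) which is
CROSSING (meets the outer layer). -/
theorem big_and_crossing_of_isCrossing (hls : lam + 1 ≤ s) {v : Site 2}
    (hv : IsCrossing (zdGraph 2) (openGraph ω) (zBall x s) (zBall x (2 * s)) v) :
    (∃ w ∈ blobOf (openGraph ω) (zBall x (2 * s) \ zBall x s) v,
        ∃ w' ∈ blobOf (openGraph ω) (zBall x (2 * s) \ zBall x s) v, (lam : ℤ) ≤ zNorm (w - w')) ∧
      ∃ w ∈ blobOf (openGraph ω) (zBall x (2 * s) \ zBall x s) v,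
        w ∈ outerLayer (zdGraph 2) (zBall x s) (zBall x (2 * s)) := by
  obtain ⟨hvL, w₁, hw₁o, hp⟩ := hv
  refine ⟨⟨w₁, hp, v, NeckCoarse.self_mem_blobOf hvL.1, ?_⟩, w₁, hp, hw₁o⟩
  have h1 := zNorm_eq_of_mem_innerLayer hvL
  have h2 := zNorm_eq_of_mem_outerLayer hw₁o
  have h3 := zNorm_sub_le_add w₁ v x
  omega

/-- The square annulus of outer radius `R ≤ s - 1` around an inner-layer vertex lies inside the big ball. -/
theorem zAnn_subset_zBall {w : Site 2} (hw : w ∈ innerLayer (zdGraph 2) (zBall x s) (zBall x (2 * s))) {r R : ℕ}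
    (hR : R + 1 ≤ s) : zAnn w r R ⊆ zBall x (2 * s) := by
  intro z hz
  have h1 := zNorm_eq_of_mem_innerLayer hw
  have h2 := zNorm_sub_le_add z w x
  have h3 := hz.2
  change zNorm (z - x) ≤ (2 * s : ℕ)
  push_cast
  omega

/-! ## §3 Crossing extraction -/

-- adapted from `Literature.Probability.Percolation.PathIn.last_exit_or` (SitePaths), with the prefix kept
/-- **Last visit, with prefix**: an open path inside `A` from a vertex of `C` either ends in `C`, or contains an open
edge `a ∼ b` with `a ∈ C`, `b ∉ C`, preceded by an open path inside `A` from the start to `a` and followed by an open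
path inside `A ∖ C` from `b` to the end. -/
theorem openPathIn_last_exit_prefix_or {A C : Set (Site 2)} {u v : Site 2} (h : PathIn (openGraph ω) A u v)
    (hu : u ∈ C) : v ∈ C ∨ ∃ a b, a ∈ C ∧ PathIn (openGraph ω) A u a ∧ b ∉ C ∧ (openGraph ω).Adj a b ∧
      PathIn (openGraph ω) (A \ C) b v := by
  obtain ⟨huA, p⟩ := h
  induction p with
  | refl => exact Or.inl hu
  | @tail b c hub hbc ih =>
    by_cases hc : c ∈ C
    · exact Or.inl hc
    · right
      by_cases hb : b ∈ C
      · exact ⟨b, c, hb, ⟨huA, hub⟩, hc, hbc.1, PathIn.refl ⟨hbc.2, hc⟩⟩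
      · rcases ih with ih | ⟨a, b', ha, hpa, hb', hab', hp⟩
        · exact absurd ih hb
        · exact ⟨a, b', ha, hpa, hb', hab', hp.tail hbc.1 ⟨hbc.2, hc⟩⟩

/-- **Last visit, with prefix** (the exit form). -/
theorem openPathIn_last_exit_prefix {A C : Set (Site 2)} {u v : Site 2} (h : PathIn (openGraph ω) A u v)
    (hu : u ∈ C) (hv : v ∉ C) :
    ∃ a b, a ∈ C ∧ PathIn (openGraph ω) A u a ∧ b ∉ C ∧ (openGraph ω).Adj a b ∧
      PathIn (openGraph ω) (A \ C) b v := by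
  rcases openPathIn_last_exit_prefix_or h hu with h' | h'
  · exact absurd h' hv
  · exact h'

/-- **Crossing extraction**: an open path (inside any region `S`) whose steps are lattice edges, from inside
`Λ_{r-1}(w)` to outside `Λ_{R-1}(w)`, contains a crossing of the annulus `zAnn w r R`, inside `S`, whose start is joined
to the start of the path inside `S`. -/
theorem exists_zAnn_crossing_of_pathIn (hHG : ∀ a b, (openGraph ω).Adj a b → (zdGraph 2).Adj a b)
    {S : Set (Site 2)} {w y q : Site 2} {r R : ℕ} (hrR : r ≤ R)
    (hy : zNorm (y - w) < r) (hq : (R : ℤ) ≤ zNorm (q - w)) (hp : PathIn (openGraph ω) S y q) :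
    ∃ p₁ q₁, zNorm (p₁ - w) = r ∧ zNorm (q₁ - w) = R ∧
      PathIn (openGraph ω) (S ∩ zAnn w r R) p₁ q₁ ∧ PathIn (openGraph ω) S y p₁ := by
  set H := openGraph ω with hH
  -- cut at the first exit from `{|· - w| < R}`
  obtain ⟨a, bb, haR, hbbR, hbbS, hadj, hpref⟩ :=
    hp.exit (R := {z | zNorm (z - w) < R}) (show zNorm (y - w) < R by omega) (show ¬ zNorm (q - w) < R by omega)
  simp only [mem_setOf_eq, not_lt] at haR hbbR
  have hbbR' : zNorm (bb - w) = R :=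
    le_antisymm (by have := zNorm_sub_le_of_adj (hHG _ _ hadj) w; omega) hbbR
  -- the path `y → a → bb` inside `T := {|· - w| ≤ R} ∩ S`
  have hsub : {z | zNorm (z - w) < R} ∩ S ⊆ {z | zNorm (z - w) ≤ R} ∩ S :=
    fun z hz ↦ ⟨le_of_lt (show zNorm (z - w) < R from hz.1), hz.2⟩
  have hpT : PathIn H ({z | zNorm (z - w) ≤ R} ∩ S) y bb := (hpref.mono hsub).tail hadj ⟨hbbR'.le, hbbS⟩
  -- last exit from `C := {|· - w| ≤ r - 1}`, keeping the prefix
  obtain ⟨a', p₁, ha'C, hya', hp₁C, hadj', hsuf⟩ :=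
    openPathIn_last_exit_prefix (C := {z | zNorm (z - w) ≤ (r : ℤ) - 1}) hpT (show zNorm (y - w) ≤ (r : ℤ) - 1 by omega)
      (show ¬ zNorm (bb - w) ≤ (r : ℤ) - 1 by omega)
  simp only [mem_setOf_eq, not_le] at ha'C hp₁C
  have hp₁r : zNorm (p₁ - w) = r :=
    le_antisymm (by have := zNorm_sub_le_of_adj (hHG _ _ hadj') w; omega) (by omega)
  refine ⟨p₁, bb, hp₁r, hbbR', hsuf.mono ?_, (hya'.mono inter_subset_right).tail hadj' (hsuf.left_mem).1.2⟩
  rintro z ⟨⟨hzR, hzS⟩, hzC⟩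
  simp only [mem_setOf_eq, not_le] at hzC
  exact ⟨hzS, by omega, hzR⟩

end NeckCoarseZ2

/-- **Crossing extraction on `ℤ²` (registered helper, anchor of this module on the crux item)**: an open lattice path
from inside `Λ_{r-1}(w)` to sup distance `≥ R` from `w`, inside any region `S`, contains an open crossing of the square
annulus `zAnn w r R` inside `S`, whose start is joined to the start of the path inside `S`
(`NeckCoarseZ2.exists_zAnn_crossing_of_pathIn`). -/
theorem zAnn_crossing_extraction : ∀ (ω : BondConfig (Site 2)), (∀ a b, (openGraph ω).Adj a b → (zdGraph 2).Adj a b) → ∀ (S : Set (Site 2)) (w y q : Site 2) (r R : ℕ), r ≤ R → zNorm (y - w) < r → (R : ℤ) ≤ zNorm (q - w) → PathIn (openGraph ω) S y q → ∃ p₁ q₁, zNorm (p₁ - w) = r ∧ zNorm (q₁ - w) = R ∧ PathIn (openGraph ω) (S ∩ NeckCoarseZ2.zAnn w r R) p₁ q₁ ∧ PathIn (openGraph ω) S y p₁ :=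
  fun _ hHG _ _ _ _ _ _ hrR hy hq hp ↦ NeckCoarseZ2.exists_zAnn_crossing_of_pathIn hHG hrR hy hq hp

end Summit.CriticalPhenomena.CardyFormulaZ2.Cruxes.NestingRigidity.PinchResampling

end
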